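/-
Copyright (c) 2026 the pub-hodgecm-mathlib formalisation cell (harness21).  Prover seat hodgecm-mathlib-F0P3a-p03 (g20): line LH7 (closer row `stub_PKtupleK2`, #181 III-127;
h413 = stmt-HodgeConjecture-24833), leaf ED. 3 road «H-SIDE CONSTRUCTION ROWS», in-house glue O7 (LH7-p03 (g3) deal 2026-09-02T07:05:31Z on the LH7 bus); 2026-09-02.
-/
import Summits.HodgeConjecture.HodgeConjecture.Theorems.F0P3cPKtupleU1Line           -- ★ (γ′) p849966∕p849979: `exists_realises₂`, `exists_realises₁`, `realises₁_unique` (+ ★ (β) p849785 `Realises₂∕₁`, O8b `PKmultOneU2Shape`)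
import Summits.HodgeConjecture.HodgeConjecture.Theorems.F0P3SpectralPacketXiHSigned   -- ★ (N) 3r: `SpectralPacketH.XiHPacketsSigned`, `rhoXiS`, `memH_rhoXiS_loc` (+ ★ 3g `SpectralPacketH`, ★ 3c `GlobalPacketH.IsCharPacket`)
import HarnessLib

/-!
# LH7 leaf ED. 3, glue O7 — «`n(ξ) = 1`»: the multiplicity row (PK-A-H♭) `nH (ρ_ξ) = 1` DERIVED from the in-∃ multiplicity tie (KD5-H♭), the `U(Φ₂)` multiplicity-one
# letter O8b and the ★ `U(1)` line ([Rogawski1990] §13.3 p. 203 «`n(ξ) = 1`», `m(ξ) = 1`; §14.6 pp. 243–244)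

Cell `pub/hodgecm-mathlib` (D-0151), crux H413 = `stmt-HodgeConjecture-24833`, half A line LH7 (closer row `stub_PKtupleK2 : PKtupleLetterK2`, books #181 III-127), leaf
`Cruxes/H413/Lines/F0_P3c_PKtuplePaydown.lean` ED. 2 (organs {O1′ XL, O2 M} PRINT; O3∕O4∕O5 TIED).  ROAD TO ED. 3 (LH7-plan (g2) `MEMO-ED3.v2` §1∕§3 (γ); LH7-plan (g3) HANDOFF g3.4;
desk F0P3-plan (g14) D64∕D64′): the posited CONSTRUCTION row (PK-A-H♭) «`∀ hXiHS ξ, nH (rhoXiS hXiHS ξ) = 1`» (leaf :194) LEAVES organ O1′ and is DERIVED by THIS glue from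
* the IN-∃ row (KD5-H♭) `KD5HflatRow 𝔩 𝔞 𝔞H DiscH nH μ₂ μ₁` of O1″ (LH7-plan (g3) fit v4 `ED3rows.fit.v4.LH7plang3.lean` f9c2a7314631e900 ll. 106–118, spelled out here as the hypothesis
  `hKD5` with `Hs₂ Hs₁ D₂ D₁` inlined exactly as ★ (β) `Theorems/F0P3cPKtupleHSideLetters` inlines them): «if `ρ_v = {⟦ξ_v⟧}` at every finite `v` and the character `ξ_H` is realised
  in `L²_disc(U(Φ₂), μ₂) ⊗ L²_disc(U(Φ₁), μ₁)` with multiplicity EXACTLY one (a realising `P₂` and a realising `P₁` exist and are unique), then `nH ρ = 1`»;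
* the kit-free PRINT letter O8b ★ (β) `PKmultOneU2Shape L` (uniqueness of the realising `P₂`; [Rogawski1990 §13.3 p. 203 «`m(ξ) = 1`»]) — or, sharper, only its instance at
  `(μ₂, ξ)`;
* the ★ `U(1)` LINE (γ′) `Theorems/F0P3cPKtupleU1Line` (F0P3a-p03 (g19), p849966∕p849979): `exists_realises₂ μ₂ ξ` (the line of `((η ψ) ∘ det)⁻¹` realises `ξ_v ∘ inl`),
  `exists_realises₁ μ₁ ξ`, `realises₁_unique ξ` — three of the four realisation premises of (KD5-H♭) are theorems, so NEITHER (KD4-H) NOR O8a is needed here (MEMO §3 (γ) listed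
  them before (γ′) landed).
THEOREMS ONLY (kernel lane; no `def`, no instance, no notation, no named fact, no `sorry`); kit-generic over the slots `𝔩 𝔞 𝔞H DiscH nH` and the shape data `PkX PkInfX εX κHX`;
the automorphic measures `μ₂ μ₁` are ARGUMENTS (the leaf ED. 3 takes them from O1″'s in-∃).  CONTENTS:
* §1 `nH_eq_one_of_kd5Hflat` — (KD5-H♭)-text + uniqueness of the realising `P₂` at `(μ₂, ξ)` + `ρ_v = {⟦ξ_v⟧}` ∀ `v` ⇒ `nH ρ = 1`; `nH_eq_one_of_kd5Hflat_of_pkMultOneU2` (the same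
  over the letter `PKmultOneU2Shape L`); `nH_eq_one_of_kd5Hflat_of_isCharPacket` (hypothesis in ★ 3c `IsCharPacket` currency).
* §2 `nH_rhoXiS_eq_one_of_kd5Hflat` — at the tuple's witness `rhoXiS hXiHS ξ` (★ 3r `memH_rhoXiS_loc`); **`pkAHflat_of_kd5Hflat`** — THE LEAF ROW (PK-A-H♭) TEXT
  `∀ hXiHS, ∀ ξ, nH (rhoXiS hXiHS ξ) = 1` with the `χ hχ` slots of ★ `XiHPacketsSigned` at `fun ξ v => ξ.xiLocalChar v` ∕ `fun ξ v => isOpen_ker_xiLocalChar L ξ v` TOKEN FOR TOKEN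
  (leaf ED. 2 :194), from `hKD5` + `PKmultOneU2Shape L`.
HONEST LABEL: count-neutral in-house glue (books row III-127 #181 stays PRINTED∕UNPROVED under `stub_PKtupleK2`); what stays PRINT on this road after ED. 3 is O1″ (incl. the
in-∃ row (KD5-H♭)), O2, O8a, O8b; HC_CM is proved only modulo the 7 printed citations (2 remaining: hLiu418 = stmt-HodgeConjecture-24832, h413 = stmt-HodgeConjecture-24833) until
rung 0 closes.

## References
* [Rogawski1990] J. D. Rogawski, *Automorphic Representations of Unitary Groups in Three Variables*, Ann. of Math. Stud. 123 (1990): §13.3 pp. 202–203 (`Π(𝐇)`, `ρ = ρ₂ ⊗ ρ₁`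
  discrete packets of `U(2) × U(1)`, «`n(ξ) = 1`», `m(ξ) = 1`), §14.6 (14.6.3) pp. 243–244, §12.1 p. 171 (one-dimensional `ξ_v` = singleton packet).
* [Gelbart1975] S. Gelbart, *Automorphic forms on adele groups* (1975), Thm. 10.10 (multiplicity one for characters; the `U(1)` factor).
-/

set_option autoImplicit false
-- the mandated namespace repeats the single-problem summit's segment (`HodgeConjecture.HodgeConjecture`)
set_option linter.dupNamespace false

noncomputable section

namespace Summit.HodgeConjecture.HodgeConjecture.Cruxes.H413.F0P3cPKtupleNHOneOfKD5H

open MeasureTheory NumberField IsDedekindDomain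
open Literature.NumberTheory Literature.NumberTheory.Automorphic Literature.NumberTheory.Automorphic.UnitaryGroup
open Literature.NumberTheory.Rogawski1990 Literature.NumberTheory.GaloisRepresentations
open Literature.RepresentationTheory.KonnoKonno2007
open Literature.NumberTheory.Automorphic.Arthur2013.Leaves.TECR
open Summit.HodgeConjecture.HodgeConjecture.Cruxes.H413.F0P3LocalPacketKit
open Summit.HodgeConjecture.HodgeConjecture.Cruxes.H413.F0P3ArchPacketKit
open Summit.HodgeConjecture.HodgeConjecture.Cruxes.H413.F0P3GlobalPacket
open Summit.HodgeConjecture.HodgeConjecture.Cruxes.H413.F0P3SpectralPacket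
open Summit.HodgeConjecture.HodgeConjecture.Cruxes.H413.F0P3SpectralPacket.SpectralPacketH
open Summit.HodgeConjecture.HodgeConjecture.Cruxes.H413.F0P3GlobalPacketDiscrete
open Summit.HodgeConjecture.HodgeConjecture.Cruxes.H413.F0P3cPKtupleHSideLetters
open Summit.HodgeConjecture.HodgeConjecture.Cruxes.H413.F0P3cPKtupleU1Line

variable {L : Type} [Field L] [NumberField L] [IsCMField L] {H' : Matrix (Fin 3) (Fin 3) L}
  {𝔩 : ∀ v : HeightOneSpectrum (𝓞 ↥(maximalRealSubfield L)), LocalPacketKit L H' v} {𝔞 : ArchPacketKit} {𝔞H : ArchPacketKitH 𝔞}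
  {DiscH : GlobalPacketH 𝔩 → 𝔞H.PktInfH → Prop}

/-! ## §1 `nH ρ = 1` for a character packet `ρ = {⟦ξ_v⟧}_v`, from the (KD5-H♭) row, uniqueness of the realising `P₂`, and the ★ `U(1)` line -/

/-- **O7, SHARP FORM — «`n(ξ) = 1`» from (KD5-H♭), the uniqueness of the realising `P₂` at `(μ₂, ξ)`, and the ★ `U(1)` line.**  Let `nH` be the kit's multiplicity slot and
`μ₂`, `μ₁` automorphic measures on `U(Φ₂)`, `U(Φ₁)` for which the IN-∃ row (KD5-H♭) holds (hypothesis `hKD5`, the text of `KD5HflatRow 𝔩 𝔞 𝔞H DiscH nH μ₂ μ₁` with the split forms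
and data inlined as in ★ `Realises₂∕₁`): «`ρ_v = {⟦ξ_v⟧}` at every finite `v`, a realising `P₂` exists and is unique, a realising `P₁` exists and is unique ⇒ `nH ρ = 1`».  If the
discrete automorphic representations of `U(Φ₂)` realising `ξ_v ∘ inl` in `L²(μ₂)` are unique (`hm1`, the instance of O8b ★ `PKmultOneU2Shape L` at `(μ₂, ξ)`), then every spectral
`H`-packet `ρ` with member sets `{⟦ξ_v⟧}` at every finite place has `nH ρ = 1`: the remaining three premises of (KD5-H♭) are ★ `exists_realises₂ μ₂ ξ` (the line of
`((η ψ) ∘ det)⁻¹`), ★ `exists_realises₁ μ₁ ξ`, ★ `realises₁_unique ξ` (multiplicity one on the commutative datum `U(Φ₁)`). [cite: Rogawski1990, §13.3 p. 203; §14.6 pp. 243–244]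
[cite: Gelbart1975, Thm. 10.10 (proof, p. 158)] -/
theorem nH_eq_one_of_kd5Hflat (nH : SpectralPacketH 𝔩 𝔞 𝔞H DiscH → ℂ)
    (μ₂ : Measure (adelicGroupData (↥(maximalRealSubfield L)) L (IsCMField.complexConj L) 2 (Matrix.of fun i j : Fin 2 => if i.val + j.val + 1 = 2 then (1 : L) else 0)).automorphicQuotient)
    [(adelicGroupData (↥(maximalRealSubfield L)) L (IsCMField.complexConj L) 2 (Matrix.of fun i j : Fin 2 => if i.val + j.val + 1 = 2 then (1 : L) else 0)).IsAutomorphicMeasure μ₂]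
    (μ₁ : Measure (adelicGroupData (↥(maximalRealSubfield L)) L (IsCMField.complexConj L) 1 (Matrix.of fun i j : Fin 1 => if i.val + j.val + 1 = 1 then (1 : L) else 0)).automorphicQuotient)
    [(adelicGroupData (↥(maximalRealSubfield L)) L (IsCMField.complexConj L) 1 (Matrix.of fun i j : Fin 1 => if i.val + j.val + 1 = 1 then (1 : L) else 0)).IsAutomorphicMeasure μ₁]
    (hKD5 : ∀ (ρ : SpectralPacketH 𝔩 𝔞 𝔞H DiscH) (ξ : OneDimAutRepH L),
      (∀ v : HeightOneSpectrum (𝓞 ↥(maximalRealSubfield L)),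
          (𝔩 v).memH (ρ.fin.loc v) = {IrrClass.mk (SmoothIrrep.ofChar (ξ.xiLocalChar v) (F0P3XiLocalCharOpenKernel.isOpen_ker_xiLocalChar L ξ v))}) →
        (∃ P₂ : DiscreteAutomorphicRep (adelicGroupData (↥(maximalRealSubfield L)) L (IsCMField.complexConj L) 2 (Matrix.of fun i j : Fin 2 => if i.val + j.val + 1 = 2 then (1 : L) else 0)) μ₂, Realises₂ P₂ ξ) →
        (∀ P₂ P₂' : DiscreteAutomorphicRep (adelicGroupData (↥(maximalRealSubfield L)) L (IsCMField.complexConj L) 2 (Matrix.of fun i j : Fin 2 => if i.val + j.val + 1 = 2 then (1 : L) else 0)) μ₂, Realises₂ P₂ ξ → Realises₂ P₂' ξ → P₂ = P₂') →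
        (∃ P₁ : DiscreteAutomorphicRep (adelicGroupData (↥(maximalRealSubfield L)) L (IsCMField.complexConj L) 1 (Matrix.of fun i j : Fin 1 => if i.val + j.val + 1 = 1 then (1 : L) else 0)) μ₁, Realises₁ P₁ ξ) →
        (∀ P₁ P₁' : DiscreteAutomorphicRep (adelicGroupData (↥(maximalRealSubfield L)) L (IsCMField.complexConj L) 1 (Matrix.of fun i j : Fin 1 => if i.val + j.val + 1 = 1 then (1 : L) else 0)) μ₁, Realises₁ P₁ ξ → Realises₁ P₁' ξ → P₁ = P₁') →
          nH ρ = 1)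
    (ρ : SpectralPacketH 𝔩 𝔞 𝔞H DiscH) (ξ : OneDimAutRepH L)
    (hm1 : ∀ P₂ P₂' : DiscreteAutomorphicRep (adelicGroupData (↥(maximalRealSubfield L)) L (IsCMField.complexConj L) 2 (Matrix.of fun i j : Fin 2 => if i.val + j.val + 1 = 2 then (1 : L) else 0)) μ₂,
      Realises₂ P₂ ξ → Realises₂ P₂' ξ → P₂ = P₂')
    (hρ : ∀ v : HeightOneSpectrum (𝓞 ↥(maximalRealSubfield L)),
      (𝔩 v).memH (ρ.fin.loc v) = {IrrClass.mk (SmoothIrrep.ofChar (ξ.xiLocalChar v) (F0P3XiLocalCharOpenKernel.isOpen_ker_xiLocalChar L ξ v))}) :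
    nH ρ = 1 :=
  hKD5 ρ ξ hρ (exists_realises₂ μ₂ ξ) hm1 (exists_realises₁ μ₁ ξ) (realises₁_unique ξ)

/-- **O7 OVER THE LETTER O8b** — the same with the uniqueness premise supplied by the kit-free PRINT letter ★ `PKmultOneU2Shape L` (multiplicity one for one-dimensional
automorphic representations of `U(Φ₂)`, [Rogawski1990 §13.3 p. 203 «`m(ξ) = 1`»]) at `(μ₂, ξ)`. [cite: Rogawski1990, §13.3 p. 203; §14.6 pp. 243–244] -/
theorem nH_eq_one_of_kd5Hflat_of_pkMultOneU2 (nH : SpectralPacketH 𝔩 𝔞 𝔞H DiscH → ℂ)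
    (μ₂ : Measure (adelicGroupData (↥(maximalRealSubfield L)) L (IsCMField.complexConj L) 2 (Matrix.of fun i j : Fin 2 => if i.val + j.val + 1 = 2 then (1 : L) else 0)).automorphicQuotient)
    [(adelicGroupData (↥(maximalRealSubfield L)) L (IsCMField.complexConj L) 2 (Matrix.of fun i j : Fin 2 => if i.val + j.val + 1 = 2 then (1 : L) else 0)).IsAutomorphicMeasure μ₂]
    (μ₁ : Measure (adelicGroupData (↥(maximalRealSubfield L)) L (IsCMField.complexConj L) 1 (Matrix.of fun i j : Fin 1 => if i.val + j.val + 1 = 1 then (1 : L) else 0)).automorphicQuotient)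
    [(adelicGroupData (↥(maximalRealSubfield L)) L (IsCMField.complexConj L) 1 (Matrix.of fun i j : Fin 1 => if i.val + j.val + 1 = 1 then (1 : L) else 0)).IsAutomorphicMeasure μ₁]
    (hKD5 : ∀ (ρ : SpectralPacketH 𝔩 𝔞 𝔞H DiscH) (ξ : OneDimAutRepH L),
      (∀ v : HeightOneSpectrum (𝓞 ↥(maximalRealSubfield L)),
          (𝔩 v).memH (ρ.fin.loc v) = {IrrClass.mk (SmoothIrrep.ofChar (ξ.xiLocalChar v) (F0P3XiLocalCharOpenKernel.isOpen_ker_xiLocalChar L ξ v))}) →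
        (∃ P₂ : DiscreteAutomorphicRep (adelicGroupData (↥(maximalRealSubfield L)) L (IsCMField.complexConj L) 2 (Matrix.of fun i j : Fin 2 => if i.val + j.val + 1 = 2 then (1 : L) else 0)) μ₂, Realises₂ P₂ ξ) →
        (∀ P₂ P₂' : DiscreteAutomorphicRep (adelicGroupData (↥(maximalRealSubfield L)) L (IsCMField.complexConj L) 2 (Matrix.of fun i j : Fin 2 => if i.val + j.val + 1 = 2 then (1 : L) else 0)) μ₂, Realises₂ P₂ ξ → Realises₂ P₂' ξ → P₂ = P₂') →
        (∃ P₁ : DiscreteAutomorphicRep (adelicGroupData (↥(maximalRealSubfield L)) L (IsCMField.complexConj L) 1 (Matrix.of fun i j : Fin 1 => if i.val + j.val + 1 = 1 then (1 : L) else 0)) μ₁, Realises₁ P₁ ξ) →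
        (∀ P₁ P₁' : DiscreteAutomorphicRep (adelicGroupData (↥(maximalRealSubfield L)) L (IsCMField.complexConj L) 1 (Matrix.of fun i j : Fin 1 => if i.val + j.val + 1 = 1 then (1 : L) else 0)) μ₁, Realises₁ P₁ ξ → Realises₁ P₁' ξ → P₁ = P₁') →
          nH ρ = 1)
    (hO8b : PKmultOneU2Shape L)
    (ρ : SpectralPacketH 𝔩 𝔞 𝔞H DiscH) (ξ : OneDimAutRepH L)
    (hρ : ∀ v : HeightOneSpectrum (𝓞 ↥(maximalRealSubfield L)),
      (𝔩 v).memH (ρ.fin.loc v) = {IrrClass.mk (SmoothIrrep.ofChar (ξ.xiLocalChar v) (F0P3XiLocalCharOpenKernel.isOpen_ker_xiLocalChar L ξ v))}) :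
    nH ρ = 1 :=
  nH_eq_one_of_kd5Hflat nH μ₂ μ₁ hKD5 ρ ξ (hO8b μ₂ ξ) hρ

/-- **O7 in ★ 3c `IsCharPacket` currency**: a spectral `H`-packet whose finite part IS the singleton packet family of the characters `ξ_v` (`ρ.fin.IsCharPacket (ξ.xiLocalChar ·) _`,
the shape ★ 3r `rhoXiS_isCharPacket` delivers) has `nH ρ = 1`, given (KD5-H♭) at `(μ₂, μ₁)` and O8b. [cite: Rogawski1990, §13.3 p. 203; §12.1 p. 171] -/
theorem nH_eq_one_of_kd5Hflat_of_isCharPacket (nH : SpectralPacketH 𝔩 𝔞 𝔞H DiscH → ℂ)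
    (μ₂ : Measure (adelicGroupData (↥(maximalRealSubfield L)) L (IsCMField.complexConj L) 2 (Matrix.of fun i j : Fin 2 => if i.val + j.val + 1 = 2 then (1 : L) else 0)).automorphicQuotient)
    [(adelicGroupData (↥(maximalRealSubfield L)) L (IsCMField.complexConj L) 2 (Matrix.of fun i j : Fin 2 => if i.val + j.val + 1 = 2 then (1 : L) else 0)).IsAutomorphicMeasure μ₂]
    (μ₁ : Measure (adelicGroupData (↥(maximalRealSubfield L)) L (IsCMField.complexConj L) 1 (Matrix.of fun i j : Fin 1 => if i.val + j.val + 1 = 1 then (1 : L) else 0)).automorphicQuotient)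
    [(adelicGroupData (↥(maximalRealSubfield L)) L (IsCMField.complexConj L) 1 (Matrix.of fun i j : Fin 1 => if i.val + j.val + 1 = 1 then (1 : L) else 0)).IsAutomorphicMeasure μ₁]
    (hKD5 : ∀ (ρ : SpectralPacketH 𝔩 𝔞 𝔞H DiscH) (ξ : OneDimAutRepH L),
      (∀ v : HeightOneSpectrum (𝓞 ↥(maximalRealSubfield L)),
          (𝔩 v).memH (ρ.fin.loc v) = {IrrClass.mk (SmoothIrrep.ofChar (ξ.xiLocalChar v) (F0P3XiLocalCharOpenKernel.isOpen_ker_xiLocalChar L ξ v))}) →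
        (∃ P₂ : DiscreteAutomorphicRep (adelicGroupData (↥(maximalRealSubfield L)) L (IsCMField.complexConj L) 2 (Matrix.of fun i j : Fin 2 => if i.val + j.val + 1 = 2 then (1 : L) else 0)) μ₂, Realises₂ P₂ ξ) →
        (∀ P₂ P₂' : DiscreteAutomorphicRep (adelicGroupData (↥(maximalRealSubfield L)) L (IsCMField.complexConj L) 2 (Matrix.of fun i j : Fin 2 => if i.val + j.val + 1 = 2 then (1 : L) else 0)) μ₂, Realises₂ P₂ ξ → Realises₂ P₂' ξ → P₂ = P₂') →
        (∃ P₁ : DiscreteAutomorphicRep (adelicGroupData (↥(maximalRealSubfield L)) L (IsCMField.complexConj L) 1 (Matrix.of fun i j : Fin 1 => if i.val + j.val + 1 = 1 then (1 : L) else 0)) μ₁, Realises₁ P₁ ξ) →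
        (∀ P₁ P₁' : DiscreteAutomorphicRep (adelicGroupData (↥(maximalRealSubfield L)) L (IsCMField.complexConj L) 1 (Matrix.of fun i j : Fin 1 => if i.val + j.val + 1 = 1 then (1 : L) else 0)) μ₁, Realises₁ P₁ ξ → Realises₁ P₁' ξ → P₁ = P₁') →
          nH ρ = 1)
    (hO8b : PKmultOneU2Shape L)
    (ρ : SpectralPacketH 𝔩 𝔞 𝔞H DiscH) (ξ : OneDimAutRepH L)
    (hρ : ρ.fin.IsCharPacket (fun v => ξ.xiLocalChar v) (fun v => F0P3XiLocalCharOpenKernel.isOpen_ker_xiLocalChar L ξ v)) :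
    nH ρ = 1 :=
  nH_eq_one_of_kd5Hflat_of_pkMultOneU2 nH μ₂ μ₁ hKD5 hO8b ρ ξ fun v => hρ v

/-! ## §2 At the tuple's witness `ρ_ξ = rhoXiS hXiHS ξ`: the leaf row (PK-A-H♭) -/

section AtTheTuple

variable {PkX : OneDimAutRepH L → ∀ v : HeightOneSpectrum (𝓞 ↥(maximalRealSubfield L)), CMLocalAPacket L H' v}
  {PkInfX : OneDimAutRepH L → LocalAPacket (GKIrrClass (uFormGroup (Fin 2) (Fin 1)))}
  {εX : OneDimAutRepH L → HeightOneSpectrum (𝓞 ↥(maximalRealSubfield L)) → ℤ} {κHX : OneDimAutRepH L → ℤ}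

/-- **O7 AT THE TUPLE'S `ρ_ξ`**: under the signed `H`-side ξ-shape ★ 3r `XiHPacketsSigned … (fun ξ v => ξ.xiLocalChar v) (fun ξ v => isOpen_ker_xiLocalChar L ξ v) εX κHX` the witness packet
`rhoXiS hXiHS ξ` has member sets `{⟦ξ_v⟧}` (★ `memH_rhoXiS_loc`), hence `nH (rhoXiS hXiHS ξ) = 1` given (KD5-H♭) at `(μ₂, μ₁)` and O8b. [cite: Rogawski1990, §13.3 p. 203; §13.1 Prop. 13.1.3 (d) p. 199] -/
theorem nH_rhoXiS_eq_one_of_kd5Hflat (nH : SpectralPacketH 𝔩 𝔞 𝔞H DiscH → ℂ)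
    (μ₂ : Measure (adelicGroupData (↥(maximalRealSubfield L)) L (IsCMField.complexConj L) 2 (Matrix.of fun i j : Fin 2 => if i.val + j.val + 1 = 2 then (1 : L) else 0)).automorphicQuotient)
    [(adelicGroupData (↥(maximalRealSubfield L)) L (IsCMField.complexConj L) 2 (Matrix.of fun i j : Fin 2 => if i.val + j.val + 1 = 2 then (1 : L) else 0)).IsAutomorphicMeasure μ₂]
    (μ₁ : Measure (adelicGroupData (↥(maximalRealSubfield L)) L (IsCMField.complexConj L) 1 (Matrix.of fun i j : Fin 1 => if i.val + j.val + 1 = 1 then (1 : L) else 0)).automorphicQuotient)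
    [(adelicGroupData (↥(maximalRealSubfield L)) L (IsCMField.complexConj L) 1 (Matrix.of fun i j : Fin 1 => if i.val + j.val + 1 = 1 then (1 : L) else 0)).IsAutomorphicMeasure μ₁]
    (hKD5 : ∀ (ρ : SpectralPacketH 𝔩 𝔞 𝔞H DiscH) (ξ : OneDimAutRepH L),
      (∀ v : HeightOneSpectrum (𝓞 ↥(maximalRealSubfield L)),
          (𝔩 v).memH (ρ.fin.loc v) = {IrrClass.mk (SmoothIrrep.ofChar (ξ.xiLocalChar v) (F0P3XiLocalCharOpenKernel.isOpen_ker_xiLocalChar L ξ v))}) →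
        (∃ P₂ : DiscreteAutomorphicRep (adelicGroupData (↥(maximalRealSubfield L)) L (IsCMField.complexConj L) 2 (Matrix.of fun i j : Fin 2 => if i.val + j.val + 1 = 2 then (1 : L) else 0)) μ₂, Realises₂ P₂ ξ) →
        (∀ P₂ P₂' : DiscreteAutomorphicRep (adelicGroupData (↥(maximalRealSubfield L)) L (IsCMField.complexConj L) 2 (Matrix.of fun i j : Fin 2 => if i.val + j.val + 1 = 2 then (1 : L) else 0)) μ₂, Realises₂ P₂ ξ → Realises₂ P₂' ξ → P₂ = P₂') →
        (∃ P₁ : DiscreteAutomorphicRep (adelicGroupData (↥(maximalRealSubfield L)) L (IsCMField.complexConj L) 1 (Matrix.of fun i j : Fin 1 => if i.val + j.val + 1 = 1 then (1 : L) else 0)) μ₁, Realises₁ P₁ ξ) →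
        (∀ P₁ P₁' : DiscreteAutomorphicRep (adelicGroupData (↥(maximalRealSubfield L)) L (IsCMField.complexConj L) 1 (Matrix.of fun i j : Fin 1 => if i.val + j.val + 1 = 1 then (1 : L) else 0)) μ₁, Realises₁ P₁ ξ → Realises₁ P₁' ξ → P₁ = P₁') →
          nH ρ = 1)
    (hO8b : PKmultOneU2Shape L)
    (hXiHS : XiHPacketsSigned 𝔩 𝔞 𝔞H DiscH PkX PkInfX (fun ξ v => ξ.xiLocalChar v) (fun ξ v => F0P3XiLocalCharOpenKernel.isOpen_ker_xiLocalChar L ξ v) εX κHX)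
    (ξ : OneDimAutRepH L) :
    nH (rhoXiS hXiHS ξ) = 1 :=
  nH_eq_one_of_kd5Hflat_of_pkMultOneU2 nH μ₂ μ₁ hKD5 hO8b (rhoXiS hXiHS ξ) ξ (memH_rhoXiS_loc hXiHS ξ)

/-- **THE LEAF ROW (PK-A-H♭) «`n(ξ) = 1`», DERIVED** (leaf `F0_P3c_PKtuplePaydown.lean` ED. 2 :194, TOKEN FOR TOKEN at generic shape data `PkX PkInfX εX κHX`):
`∀ hXiHS, ∀ ξ, nH (rhoXiS hXiHS ξ) = 1`, from the IN-∃ row (KD5-H♭) at automorphic measures `(μ₂, μ₁)` and the PRINT letter O8b ★ `PKmultOneU2Shape L`, the `U(1)` premises and the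
existence on `U(Φ₂)` being ★ (γ′).  This is the glue O7 of MEMO-ED3.v2 §3: in ED. 3 the posited row leaves organ O1′ and `PKtupleK2_of_organs` reads it from here.
[cite: Rogawski1990, §13.3 p. 203; §14.6 (14.6.3) pp. 243–244] [cite: Gelbart1975, Thm. 10.10 (proof, p. 158)] -/
theorem pkAHflat_of_kd5Hflat (nH : SpectralPacketH 𝔩 𝔞 𝔞H DiscH → ℂ)
    (μ₂ : Measure (adelicGroupData (↥(maximalRealSubfield L)) L (IsCMField.complexConj L) 2 (Matrix.of fun i j : Fin 2 => if i.val + j.val + 1 = 2 then (1 : L) else 0)).automorphicQuotient)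
    [(adelicGroupData (↥(maximalRealSubfield L)) L (IsCMField.complexConj L) 2 (Matrix.of fun i j : Fin 2 => if i.val + j.val + 1 = 2 then (1 : L) else 0)).IsAutomorphicMeasure μ₂]
    (μ₁ : Measure (adelicGroupData (↥(maximalRealSubfield L)) L (IsCMField.complexConj L) 1 (Matrix.of fun i j : Fin 1 => if i.val + j.val + 1 = 1 then (1 : L) else 0)).automorphicQuotient)
    [(adelicGroupData (↥(maximalRealSubfield L)) L (IsCMField.complexConj L) 1 (Matrix.of fun i j : Fin 1 => if i.val + j.val + 1 = 1 then (1 : L) else 0)).IsAutomorphicMeasure μ₁]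
    (hKD5 : ∀ (ρ : SpectralPacketH 𝔩 𝔞 𝔞H DiscH) (ξ : OneDimAutRepH L),
      (∀ v : HeightOneSpectrum (𝓞 ↥(maximalRealSubfield L)),
          (𝔩 v).memH (ρ.fin.loc v) = {IrrClass.mk (SmoothIrrep.ofChar (ξ.xiLocalChar v) (F0P3XiLocalCharOpenKernel.isOpen_ker_xiLocalChar L ξ v))}) →
        (∃ P₂ : DiscreteAutomorphicRep (adelicGroupData (↥(maximalRealSubfield L)) L (IsCMField.complexConj L) 2 (Matrix.of fun i j : Fin 2 => if i.val + j.val + 1 = 2 then (1 : L) else 0)) μ₂, Realises₂ P₂ ξ) →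
        (∀ P₂ P₂' : DiscreteAutomorphicRep (adelicGroupData (↥(maximalRealSubfield L)) L (IsCMField.complexConj L) 2 (Matrix.of fun i j : Fin 2 => if i.val + j.val + 1 = 2 then (1 : L) else 0)) μ₂, Realises₂ P₂ ξ → Realises₂ P₂' ξ → P₂ = P₂') →
        (∃ P₁ : DiscreteAutomorphicRep (adelicGroupData (↥(maximalRealSubfield L)) L (IsCMField.complexConj L) 1 (Matrix.of fun i j : Fin 1 => if i.val + j.val + 1 = 1 then (1 : L) else 0)) μ₁, Realises₁ P₁ ξ) →
        (∀ P₁ P₁' : DiscreteAutomorphicRep (adelicGroupData (↥(maximalRealSubfield L)) L (IsCMField.complexConj L) 1 (Matrix.of fun i j : Fin 1 => if i.val + j.val + 1 = 1 then (1 : L) else 0)) μ₁, Realises₁ P₁ ξ → Realises₁ P₁' ξ → P₁ = P₁') →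
          nH ρ = 1)
    (hO8b : PKmultOneU2Shape L) :
    ∀ hXiHS : XiHPacketsSigned 𝔩 𝔞 𝔞H DiscH PkX PkInfX (fun ξ v => ξ.xiLocalChar v) (fun ξ v => F0P3XiLocalCharOpenKernel.isOpen_ker_xiLocalChar L ξ v) εX κHX,
      ∀ ξ : OneDimAutRepH L, nH (rhoXiS hXiHS ξ) = 1 :=
  fun hXiHS ξ => nH_rhoXiS_eq_one_of_kd5Hflat nH μ₂ μ₁ hKD5 hO8b hXiHS ξ

end AtTheTuple

end Summit.HodgeConjecture.HodgeConjecture.Cruxes.H413.F0P3cPKtupleNHOneOfKD5H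

end
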